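import Literature.AnabelianGeometry.Anabelioids.TrivialObjectFibre

/-!
# Subobjects of a trivial object `∐_J 1` of a Galois category, read on the fibre

Mathlib-level lemmas for the anabelioid dictionary ([SGA1, Exp. V §4–5]).  For a Galois category
`C` with fibre functor `F`, a finite set of sheets `J` and a monomorphism `m : Y ↪ ∐_{j ∈ J} 1`:

* `subobjectMk_sigma_ι_le_iff_mem_range`: the sheet `j` lies in `Y` (i.e. `1 ↪_j ∐ 1` factors
  through `m`) iff its fibre point lies in the image of `F(m)` — so "the set of sheets of `Y`" is
  read on ANY fibre functor;
* `isIso_of_forall_sheet_mem_range`: if every sheet lies in `Y` then `m` is an isomorphism;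
* `isInitial_of_forall_sheet_not_mem_range`: if no sheet lies in `Y` then `Y` is initial.

These are the local ingredients of "a covering that is connected over `ℍ` gives a CONNECTED object
of `B(𝒢_ℍ)`" in the proof of [SemiAnbd] Proposition 2.6 (p. 29).  Proof-only, no definitions.
-/

namespace Literature.AnabelianGeometry.Anabelioids

open CategoryTheory CategoryTheory.Limits CategoryTheory.PreGaloisCategory

universe w u₂ u₁

variable {C : Type u₁} [Category.{u₂} C] [GaloisCategory C]
variable (F : C ⥤ FintypeCat.{w}) [FiberFunctor F] (J : Type w) [Finite J]

/-- Every point of the fibre of `∐_J 1` is the fibre point of some sheet. [cite: SGA1, Exp. V §5] -/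
theorem exists_eq_map_sigma_ι (t : F.obj (⊤_ C)) (x : F.obj (∐ fun _ : J => ⊤_ C)) :
    ∃ j : J, x = F.map (Sigma.ι (fun _ : J => ⊤_ C) j) t := by
  haveI := subsingleton_fiber_terminal F
  obtain ⟨⟨j⟩, y, hy⟩ := Concrete.isColimit_exists_rep _
    (isColimitOfPreserves F (colimit.isColimit (Discrete.functor fun _ : J => ⊤_ C))) x
  obtain ⟨y, rfl⟩ : ∃ y' : F.obj (⊤_ C), y' = y := ⟨y, rfl⟩
  refine ⟨j, ?_⟩
  rw [← hy, Subsingleton.elim y t]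
  rfl

variable {F J}

/-- **The sheets of a subobject of `∐_J 1` are read on the fibre**: for a monomorphism
`m : Y ↪ ∐_J 1`, the summand `1 ↪_j ∐_J 1` factors through `m` iff its fibre point is in the image
of `F(m)`. [cite: SGA1, Exp. V §5] -/
theorem subobjectMk_sigma_ι_le_iff_mem_range {Y : C} (m : Y ⟶ ∐ fun _ : J => ⊤_ C) [Mono m]
    (j : J) (t : F.obj (⊤_ C)) :
    haveI : Mono (Sigma.ι (fun _ : J => ⊤_ C) j) :=
      MonoCoprod.mono_inj (fun _ : J => ⊤_ C) (colimit.cocone (Discrete.functor fun _ : J => ⊤_ C))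
        (colimit.isColimit _) j
    Subobject.mk (Sigma.ι (fun _ : J => ⊤_ C) j) ≤ Subobject.mk m ↔
      F.map (Sigma.ι (fun _ : J => ⊤_ C) j) t ∈ Set.range (F.map m) := by
  haveI : Mono (Sigma.ι (fun _ : J => ⊤_ C) j) :=
    MonoCoprod.mono_inj (fun _ : J => ⊤_ C) (colimit.cocone (Discrete.functor fun _ : J => ⊤_ C))
      (colimit.isColimit _) j
  haveI : IsConnected (⊤_ C) := isConnected_terminal
  constructor
  · intro h
    refine ⟨F.map (Subobject.ofMkLEMk _ _ h) t, ?_⟩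
    change (F.map (Subobject.ofMkLEMk _ _ h) ≫ F.map m) t = _
    rw [← F.map_comp, Subobject.ofMkLEMk_comp]
  · rintro ⟨y, hy⟩
    -- the connected component of `Y` through `y` is the sheet `j`
    obtain ⟨Z, i, z, hz, hZ, hi⟩ := fiber_in_connected_component F Y y
    haveI := hZ
    haveI := hi
    haveI : Mono (i ≫ m) := mono_comp _ _
    have h1 : F.map (i ≫ m) z = F.map (Sigma.ι (fun _ : J => ⊤_ C) j) t := by
      rw [F.map_comp]
      change F.map m (F.map i z) = _
      rw [hz, hy]
    obtain ⟨f, hf⟩ := connected_component_unique F z t (i ≫ m) (Sigma.ι (fun _ : J => ⊤_ C) j) h1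
    have hcomm : f.hom ≫ Sigma.ι (fun _ : J => ⊤_ C) j = i ≫ m := by
      apply F.map_injective
      obtain ⟨e⟩ := nonempty_equiv_fiber_terminal_punit F
      have hsub : Subsingleton (F.obj Z) :=
        ((FintypeCat.incl.mapIso (F.mapIso f)).toEquiv.trans e).subsingleton
      ext x
      rw [Subsingleton.elim x z, F.map_comp]
      change F.map (Sigma.ι (fun _ : J => ⊤_ C) j) (F.map f.hom z) = F.map (i ≫ m) z
      rw [hf, h1]
    calc Subobject.mk (Sigma.ι (fun _ : J => ⊤_ C) j)
        = Subobject.mk (i ≫ m) := (Subobject.mk_eq_mk_of_comm _ _ f hcomm).symm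
      _ ≤ Subobject.mk m := Subobject.mk_le_mk_of_comm i rfl

/-- If every sheet lies in the subobject `m : Y ↪ ∐_J 1` (read on the fibre), then `m` is an
isomorphism. [cite: SGA1, Exp. V §5] -/
theorem isIso_of_forall_sheet_mem_range {Y : C} (m : Y ⟶ ∐ fun _ : J => ⊤_ C) [Mono m]
    (t : F.obj (⊤_ C))
    (h : ∀ j : J, F.map (Sigma.ι (fun _ : J => ⊤_ C) j) t ∈ Set.range (F.map m)) : IsIso m := by
  apply isIso_of_mono_of_eq_card_fiber F m
  have hinj : Function.Injective (F.map m) :=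
    ConcreteCategory.injective_of_mono_of_preservesPullback (F.map m)
  have hsurj : Function.Surjective (F.map m) := by
    intro x
    obtain ⟨j, rfl⟩ := exists_eq_map_sigma_ι F J t x
    obtain ⟨y, hy⟩ := h j
    exact ⟨y, hy⟩
  exact Nat.card_congr (Equiv.ofBijective _ ⟨hinj, hsurj⟩)

/-- If no sheet lies in the subobject `m : Y ↪ ∐_J 1` (read on the fibre), then `Y` is initial.
[cite: SGA1, Exp. V §5] -/
theorem isInitial_of_forall_sheet_not_mem_range {Y : C} (m : Y ⟶ ∐ fun _ : J => ⊤_ C)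
    (t : F.obj (⊤_ C))
    (h : ∀ j : J, F.map (Sigma.ι (fun _ : J => ⊤_ C) j) t ∉ Set.range (F.map m)) :
    Nonempty (IsInitial Y) := by
  rw [initial_iff_fiber_empty F]
  constructor
  intro y
  obtain ⟨j, hj⟩ := exists_eq_map_sigma_ι F J t (F.map m y)
  exact h j ⟨y, hj⟩

end Literature.AnabelianGeometry.Anabelioids
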